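import Literature.Probability.LatticeModels.WeakBeurlingEstimate
import HarnessLib

/-!
# Lattice harmonic measure on `ℤ²`, the two-constant bound, and the weak Beurling estimate for it

Topic `Literature/Probability/LatticeModels`; a short companion to `WeakBeurlingEstimate.lean`
packaging the weak discrete Beurling estimate (Kesten 1987; Smirnov 2010, Appendix B, Lemma B.2)
in the two forms in which the proof of Smirnov's Lemma B.3 (ibid.; step B3 of the S18 road in
`Sweep1Proofs.lean`, §2b) consumes it:

* `latticeHM T B` — the **harmonic measure** of `B` for the nearest-neighbour Laplacian on a
  finite `T ⊆ ℤ²`: the solution of the discrete Dirichlet problem on `T`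
  (`exists_isLatticeHarmonicOn_eq_off`, `LatticeLaplacian.lean`) with boundary data `1_B`, read on
  the outer vertex boundary `∂T` (Lawler–Limic 2010, §6.1–6.2; the hitting distribution of the
  simple random walk stopped on leaving `T`); harmonic on `T`, equal to `1_B` off `T`, with values
  in `[0, 1]`;
* `le_add_mul_latticeHM` — the **two-constant bound** (maximum principle): a subharmonic `h` on
  `T` with `h ≤ M` on `∂T` and `h ≤ m` on `∂T ∖ B` satisfies
  `h ≤ m + (M - m) ω_T(·, B)` on `T`;
* `latticeHM_compl_sqBox_le_of_cutPath` / `_of_noCircuit` — **weak Beurling for harmonic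
  measure**: the harmonic measure of the far part `∂T ∖ sqBox p R` seen from `z ∈ T ∩ sqBox p ρ` is
  `≤ C ((ρ+1)/(R+1))^β` as soon as `p` is joined to the outside of `sqBox p R` by a lattice path
  avoiding `T` (or no circuit of `T ∩ sqBox p R` winds around `p`);
* `le_add_rpow_of_cutPath` / `_of_noCircuit` — the combination used in Lemma B.3: `h` subharmonic
  on `T`, `h ≤ 1` on `∂T`, `h ≤ η` on `∂T ∩ sqBox p R` give `h(z) ≤ η + C ((ρ+1)/(R+1))^β` on
  `T ∩ sqBox p ρ` ("`H_j` is at most `ε(δ/r)` on `a^δ b^δ ∖ W`", Smirnov 2010, proof of Lemma B.3,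
  with the a-priori error `η` of the boundary values added).

Everything is proved; constants `C = WeakBeurling.beurlingConst ≥ 1`,
`β = WeakBeurling.beurlingExp > 0` from `WeakBeurlingEstimate.lean`.

## References

* S. Smirnov, *Conformal invariance in random cluster models. I*, Ann. of Math. 172 (2010),
  Appendix B, Lemmas B.2, B.3 [Smirnov2010].
* H. Kesten, *Hitting probabilities of random walks on `ℤ^d`*, Stoch. Proc. Appl. 25 (1987)
  [Kesten1987].
* G. F. Lawler, V. Limic, *Random Walk: A Modern Introduction* (2010), §6.1–6.2 [LawlerLimic2010].
-/

noncomputable section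

namespace Literature.Probability.LatticeModels

open WeakBeurling

/-! ### Harmonic measure of a finite subset of `ℤ²` -/

open Classical in
/-- **Lattice harmonic measure** `ω_T(·, B)`: for finite `T ⊆ ℤ²`, the function harmonic on `T`
(nearest-neighbour Laplacian) and equal to the indicator of `B` off `T`; only `B ∩ ∂T` matters on
`T`. (For infinite `T` the junk value `0`.) [cite: LawlerLimic2010, §6.2] -/
def latticeHM (T B : Set (Site 2)) : Site 2 → ℝ :=
  if hT : T.Finite then (exists_isLatticeHarmonicOn_eq_off hT (B.indicator fun _ => (1 : ℝ))).choose else 0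

variable {T B : Set (Site 2)}

/-- The harmonic measure is harmonic on `T`. [folklore] -/
theorem latticeHM_harmonicOn (hT : T.Finite) (B : Set (Site 2)) : IsLatticeHarmonicOn (latticeHM T B) T := by
  unfold latticeHM
  rw [dif_pos hT]
  exact (exists_isLatticeHarmonicOn_eq_off hT (B.indicator fun _ => (1 : ℝ))).choose_spec.1

/-- Off `T` the harmonic measure is the indicator of `B`. [folklore] -/
theorem latticeHM_of_not_mem (hT : T.Finite) {w : Site 2} (hw : w ∉ T) :
    latticeHM T B w = B.indicator (fun _ => (1 : ℝ)) w := by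
  unfold latticeHM
  rw [dif_pos hT]
  exact (exists_isLatticeHarmonicOn_eq_off hT (B.indicator fun _ => (1 : ℝ))).choose_spec.2 w hw

/-- Off `T`, on `B`, the harmonic measure is `1`. [folklore] -/
theorem latticeHM_of_not_mem_of_mem (hT : T.Finite) {w : Site 2} (hw : w ∉ T) (hwB : w ∈ B) : latticeHM T B w = 1 := by
  rw [latticeHM_of_not_mem hT hw, Set.indicator_of_mem hwB]

/-- Off `T` and off `B` the harmonic measure is `0`. [folklore] -/
theorem latticeHM_of_not_mem_of_not_mem (hT : T.Finite) {w : Site 2} (hw : w ∉ T) (hwB : w ∉ B) : latticeHM T B w = 0 := by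
  rw [latticeHM_of_not_mem hT hw, Set.indicator_of_notMem hwB]

/-- Off `T` the harmonic measure lies in `[0, 1]`. [folklore] -/
theorem latticeHM_mem_Icc_of_not_mem (hT : T.Finite) {w : Site 2} (hw : w ∉ T) :
    0 ≤ latticeHM T B w ∧ latticeHM T B w ≤ 1 := by
  by_cases hwB : w ∈ B
  · rw [latticeHM_of_not_mem_of_mem hT hw hwB]; exact ⟨zero_le_one, le_rfl⟩
  · rw [latticeHM_of_not_mem_of_not_mem hT hw hwB]; exact ⟨le_rfl, zero_le_one⟩

/-- **`0 ≤ ω ≤ 1`** everywhere (maximum principle). [folklore] -/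
theorem latticeHM_mem_Icc (hT : T.Finite) (B : Set (Site 2)) (w : Site 2) : 0 ≤ latticeHM T B w ∧ latticeHM T B w ≤ 1 := by
  by_cases hw : w ∈ T
  · have hb : ∀ u ∈ latticeOuterBoundary T, 0 ≤ latticeHM T B u ∧ latticeHM T B u ≤ 1 :=
      fun u hu => latticeHM_mem_Icc_of_not_mem hT hu.1
    exact ⟨(latticeHM_harmonicOn hT B).superharmonicOn.ge_of_forall_boundary_ge hT (fun u hu => (hb u hu).1) w hw,
      (latticeHM_harmonicOn hT B).subharmonicOn.le_of_forall_boundary_le hT (fun u hu => (hb u hu).2) w hw⟩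
  · exact latticeHM_mem_Icc_of_not_mem hT hw

/-- **The two-constant bound.** If `h` is subharmonic on the finite set `T`, `h ≤ M` on `∂T` and
`h ≤ m` on `∂T ∖ B`, then `h ≤ m + (M - m) ω_T(·, B)` on `T` (comparison with the
harmonic right-hand side, whose boundary values are `M` on `B` and `m` off `B`). [cite: LawlerLimic2010, §6.2] -/
theorem le_add_mul_latticeHM (hT : T.Finite) {h : Site 2 → ℝ} (hh : IsLatticeSubharmonicOn h T) {m M : ℝ}
    (hM : ∀ w ∈ latticeOuterBoundary T, h w ≤ M) (hm : ∀ w ∈ latticeOuterBoundary T, w ∉ B → h w ≤ m) :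
    ∀ z ∈ T, h z ≤ m + (M - m) * latticeHM T B z := by
  have hsup : IsLatticeSuperharmonicOn (fun z => m + (M - m) * latticeHM T B z) T := fun v hv => by
    have e1 : (fun z => m + (M - m) * latticeHM T B z) = fun z => (fun z => (M - m) * latticeHM T B z) z + m := by
      funext z; ring
    rw [e1, latticeLaplacian_add_const, latticeLaplacian_const_mul, latticeHM_harmonicOn hT B v hv, mul_zero]
  intro z hz
  have key := le_of_sub_super_of_boundary hT hh hsup (c := 0) (fun w hw => ?_) z hz
  · simpa using key
  rw [add_zero]
  by_cases hwB : w ∈ B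
  · rw [latticeHM_of_not_mem_of_mem hT hw.1 hwB]
    have := hM w hw
    linarith
  · rw [latticeHM_of_not_mem_of_not_mem hT hw.1 hwB]
    have := hm w hw hwB
    linarith

/-! ### The weak Beurling estimate for harmonic measure -/

/-- **Weak Beurling for harmonic measure, cut form.** For finite `T ⊆ ℤ²` and a site `p` joined to
the outside of `sqBox p R` by a lattice path avoiding `T`, the harmonic measure of the far part
`(sqBox p R)ᶜ` of the boundary is at most `C ((ρ+1)/(R+1))^β` at the points of `T ∩ sqBox p ρ`
(Smirnov 2010, Lemma B.2: "`H(z) < ε(δ/r)`", with `ε(t) = C t^β`). [cite: Smirnov2010, Appendix B, Lemma B.2] -/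
theorem latticeHM_compl_sqBox_le_of_cutPath (hT : T.Finite) {p : Site 2} {R : ℕ} {d : Site 2} (q : (zdGraph 2).Walk p d)
    (hd : d ∉ sqBox p R) (hq : ∀ z ∈ q.support, z ∉ T) {ρ : ℕ} {z : Site 2} (hzT : z ∈ T) (hz : z ∈ sqBox p ρ) :
    latticeHM T (sqBox p R)ᶜ z ≤ beurlingConst * (((ρ : ℝ) + 1) / ((R : ℝ) + 1)) ^ beurlingExp :=
  weakBeurling_of_cutPath hT (latticeHM_harmonicOn hT _) (fun _ hw => (latticeHM_mem_Icc_of_not_mem hT hw.1).2)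
    (fun _ hw hwR => latticeHM_of_not_mem_of_not_mem hT hw.1 (Set.notMem_compl_iff.2 hwR)) q hd hq hzT hz

/-- **Weak Beurling for harmonic measure, circuit form.** [cite: Smirnov2010, Appendix B, Lemma B.2] -/
theorem latticeHM_compl_sqBox_le_of_noCircuit (hT : T.Finite) {p : Site 2} {R : ℕ}
    (hW : ∀ (c : Site 2) (W : (zdGraph 2).Walk c c), (∀ z ∈ W.support, z ∈ T ∧ z ∈ sqBox p R) →
      Literature.Probability.Percolation.walkWinding W p = 0)
    {ρ : ℕ} {z : Site 2} (hzT : z ∈ T) (hz : z ∈ sqBox p ρ) :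
    latticeHM T (sqBox p R)ᶜ z ≤ beurlingConst * (((ρ : ℝ) + 1) / ((R : ℝ) + 1)) ^ beurlingExp :=
  weakBeurling_of_noCircuit hT (latticeHM_harmonicOn hT _) (fun _ hw => (latticeHM_mem_Icc_of_not_mem hT hw.1).2)
    (fun _ hw hwR => latticeHM_of_not_mem_of_not_mem hT hw.1 (Set.notMem_compl_iff.2 hwR)) hW hzT hz

/-- **The form used in Smirnov's Lemma B.3, cut version.** Let `h` be subharmonic on the finite
set `T`, `h ≤ 1` on `∂T` and `h ≤ η` on `∂T ∩ sqBox p R` (`0 ≤ η`), and let `p` be joined to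
the outside of `sqBox p R` by a lattice path avoiding `T`. Then
`h(z) ≤ η + C ((ρ+1)/(R+1))^β` for `z ∈ T ∩ sqBox p ρ`. [cite: Smirnov2010, Appendix B, proof of Lemma B.3] -/
theorem le_add_rpow_of_cutPath (hT : T.Finite) {h : Site 2 → ℝ} (hh : IsLatticeSubharmonicOn h T)
    (h1 : ∀ w ∈ latticeOuterBoundary T, h w ≤ 1) {p : Site 2} {R : ℕ} {η : ℝ} (hη0 : 0 ≤ η)
    (hη : ∀ w ∈ latticeOuterBoundary T, w ∈ sqBox p R → h w ≤ η)
    {d : Site 2} (q : (zdGraph 2).Walk p d) (hd : d ∉ sqBox p R) (hq : ∀ z ∈ q.support, z ∉ T)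
    {ρ : ℕ} {z : Site 2} (hzT : z ∈ T) (hz : z ∈ sqBox p ρ) :
    h z ≤ η + beurlingConst * (((ρ : ℝ) + 1) / ((R : ℝ) + 1)) ^ beurlingExp := by
  have htc := le_add_mul_latticeHM hT hh h1 (m := η) (B := (sqBox p (R : ℤ))ᶜ)
    (fun w hw hwB => hη w hw (by simpa using hwB)) z hzT
  have hB := latticeHM_compl_sqBox_le_of_cutPath hT q hd hq hzT hz
  have h0 := (latticeHM_mem_Icc hT (sqBox p (R : ℤ))ᶜ z).1
  nlinarith

/-- **The form used in Smirnov's Lemma B.3, circuit version.** [cite: Smirnov2010, Appendix B, proof of Lemma B.3] -/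
theorem le_add_rpow_of_noCircuit (hT : T.Finite) {h : Site 2 → ℝ} (hh : IsLatticeSubharmonicOn h T)
    (h1 : ∀ w ∈ latticeOuterBoundary T, h w ≤ 1) {p : Site 2} {R : ℕ} {η : ℝ} (hη0 : 0 ≤ η)
    (hη : ∀ w ∈ latticeOuterBoundary T, w ∈ sqBox p R → h w ≤ η)
    (hW : ∀ (c : Site 2) (W : (zdGraph 2).Walk c c), (∀ z ∈ W.support, z ∈ T ∧ z ∈ sqBox p R) →
      Literature.Probability.Percolation.walkWinding W p = 0)
    {ρ : ℕ} {z : Site 2} (hzT : z ∈ T) (hz : z ∈ sqBox p ρ) :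
    h z ≤ η + beurlingConst * (((ρ : ℝ) + 1) / ((R : ℝ) + 1)) ^ beurlingExp := by
  have htc := le_add_mul_latticeHM hT hh h1 (m := η) (B := (sqBox p (R : ℤ))ᶜ)
    (fun w hw hwB => hη w hw (by simpa using hwB)) z hzT
  have hB := latticeHM_compl_sqBox_le_of_noCircuit hT hW hzT hz
  have h0 := (latticeHM_mem_Icc hT (sqBox p (R : ℤ))ᶜ z).1
  nlinarith

end Literature.Probability.LatticeModels
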